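import Literature.NumberTheory.Transcendental.KZRulesAssociator
import Literature.NumberTheory.Transcendental.LindemannWeierstrassProofs
import Literature.NumberTheory.Transcendental.KZLogCalculusProofs
import Summits.KontsevichZagierPeriods.KontsevichZagierPeriods.Theorems.HurwitzSectorComplement.Negative.DimZero

/-!
# `π`-cancellation on the eval-reflecting sector (crux lead, stmt-KontsevichZagierPeriods-13633, `--supports`)

Helper file of the crux lead of `BetaCancellation` (route TerasomaMultiplication), line
`dirichlet-companion-to-pi`. The tree proves `BetaCancellation ↔ KZ.PiCancellation`
(`BetaCancellationLine.betaCancellation_iff_piCancellation`), so the only open stub of the line is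
`KZ.PiCancellation` itself (item stmt-KontsevichZagierPeriods-0540: `[π]` is a non-zero-divisor of
the formal period ring `P = FormalRep ⧸ relations`). This file records, sorry-free, the part of that
statement which the tree CAN prove today, in the ring language of `KZ.FormalPeriodRing`:

* `piCancellation_iff_forall_formalPeriod` — `PiCancellation ↔ ∀ x : P, ⟦π⟧ * x = 0 → x = 0`;
* `eq_zero_of_piClass_mul_of_evalP` — **the sector principle**: `⟦π⟧ * x = 0 → x = 0` for every
  class `x` at which evaluation reflects zero (`evalP x = 0 → x = 0`, Conjecture 1 at `x`): by
  soundness and multiplicativity of evaluation, `π · evalP x = 0` and `π ≠ 0`;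
  `mem_relations_of_piRep_mul_of_eval` is the same in `FormalRep` typing;
* `eq_zero_of_sum_algebraic_mul_pi_pow` — Lindemann in the form used here: an algebraic-coefficient
  polynomial relation `∑ αᵢ πⁱ = 0` has all `αᵢ = 0` (the tree's `transcendental_pi_holds`,
  pushed to the real algebraic closure by `Transcendental.subalgebraAlgebraicClosure`);
* `of_mem_relations_of_dim_zero_of_value_eq_zero` — a constant (`IntegralRep 0`) of value `0` is
  a relation (constants have algebraic values: REUSED tree lemma
  `HurwitzSectorComplement.Negative.isAlgebraic_value_dimZero`);
* `eq_zero_of_piClass_mul_of_piPolynomial` — **the `π`-polynomial sector of item 0540**: every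
  class `x = ∑ᵢ ⟦κᵢ⟧ ⟦π⟧ⁱ` with constant coefficients `κᵢ : IntegralRep 0` is eval-reflecting, hence
  `⟦π⟧ * x = 0 → x = 0`; `mem_relations_of_piRep_mul_of_piPolynomial` is the `FormalRep` form and
  `stub_piPolynomialSector` its closed, fully qualified registration (sub-goal of the crux item).

What is NOT here: any class outside an eval-injective sector. The general statement is the open
effective-versus-`π`-localised injectivity problem (Huber–Wüstholz 2022, App. A.3/A.4; Ayoub 2015,
Rem. 1.3), item 0540.
-/

noncomputable section

-- `Summit.KontsevichZagierPeriods.KontsevichZagierPeriods.…` is the tree's mandated layout (single-conjunct summit).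
set_option linter.dupNamespace false

namespace Summit.KontsevichZagierPeriods.KontsevichZagierPeriods.BetaCancellationLine

open Set MeasureTheory
open Literature.NumberTheory.Transcendental
open Literature.NumberTheory.Transcendental.KZ
open Summit.KontsevichZagierPeriods.Theorems.HurwitzSectorComplement.Negative
  (isAlgebraic_value_dimZero)

/-! ## The crux's open stub in ring language -/

/-- **`π`-cancellation in the formal period ring**: `KZ.PiCancellation` says exactly that the class
`⟦[π]⟧` kills no non-zero element of `P = FormalRep ⧸ relations`. [folklore] -/
theorem piCancellation_iff_forall_formalPeriod :
    PiCancellation ↔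
      ∀ x : FormalPeriodRing, toFormalPeriod (of piRep) * x = 0 → x = 0 := by
  constructor
  · intro h x hx
    obtain ⟨c, rfl⟩ := toFormalPeriod_surjective x
    rw [← map_mul, toFormalPeriod_eq_zero_iff] at hx
    exact toFormalPeriod_eq_zero_iff.mpr (h c hx)
  · intro h c hc
    have := h (toFormalPeriod c) (by rw [← map_mul, toFormalPeriod_eq_zero_iff]; exact hc)
    exact toFormalPeriod_eq_zero_iff.mp this

/-- `evalP ⟦[π]⟧ = π`. [Kontsevich–Zagier 2001, §1.1, eq. (1)] [folklore] -/
theorem evalP_piClass : evalP (toFormalPeriod (of piRep)) = Real.pi := by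
  rw [evalP_toFormalPeriod_of, piRep_value]

/-! ## The sector principle: `⟦π⟧` cancels at every eval-reflecting class -/

/-- **Sector principle (ring form).** If evaluation reflects zero at `x` (Conjecture 1 holds at the
class `x`), then `⟦π⟧ * x = 0 → x = 0`: evaluating, `π · evalP x = 0` with `π ≠ 0`. [folklore] -/
theorem eq_zero_of_piClass_mul_of_evalP {x : FormalPeriodRing} (hx : evalP x = 0 → x = 0)
    (h : toFormalPeriod (of piRep) * x = 0) : x = 0 := by
  apply hx
  have h0 : evalP (toFormalPeriod (of piRep) * x) = 0 := by rw [h, map_zero]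
  rw [map_mul, evalP_piClass] at h0
  exact (mul_eq_zero.mp h0).resolve_left Real.pi_ne_zero

/-- **Sector principle (`FormalRep` form).** If `eval c = 0 → c ∈ relations`, then
`[π] * c ∈ relations → c ∈ relations`. [folklore] -/
theorem mem_relations_of_piRep_mul_of_eval {c : FormalRep} (hc : eval c = 0 → c ∈ relations)
    (h : of piRep * c ∈ relations) : c ∈ relations := by
  rw [← toFormalPeriod_eq_zero_iff] at h ⊢
  rw [map_mul] at h
  exact eq_zero_of_piClass_mul_of_evalP
    (fun h0 => toFormalPeriod_eq_zero_iff.mpr (hc (by simpa using h0))) h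

/-! ## Lindemann, in the form used here -/

/-- **An algebraic-coefficient polynomial relation in `π` is trivial**: if `αᵢ` are real algebraic
numbers with `∑ᵢ αᵢ πⁱ = 0` then every `αᵢ = 0` (Lindemann 1882, the tree's
`transcendental_pi_holds`, extended to the real algebraic closure of `ℚ`). [folklore] -/
theorem eq_zero_of_sum_algebraic_mul_pi_pow {k : ℕ} (α : Fin k → ℝ)
    (hα : ∀ i, IsAlgebraic ℚ (α i)) (h : ∑ i, α i * Real.pi ^ (i : ℕ) = 0) :
    ∀ i, α i = 0 := by
  set A : Subalgebra ℚ ℝ := Subalgebra.algebraicClosure ℚ ℝ with hA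
  have hπ : Transcendental A Real.pi :=
    (transcendental_pi_holds : Transcendental ℚ Real.pi).subalgebraAlgebraicClosure
  let a : Fin k → A := fun i => ⟨α i, show α i ∈ Subalgebra.algebraicClosure ℚ ℝ from hα i⟩
  let f : Polynomial A := ∑ i : Fin k, Polynomial.C (a i) * Polynomial.X ^ (i : ℕ)
  have hf : Polynomial.aeval Real.pi f = 0 := by
    simp only [f, map_sum, map_mul, Polynomial.aeval_C, Polynomial.aeval_X_pow]
    simpa [a, Subalgebra.algebraMap_def] using h
  have hf0 : f = 0 := by
    by_contra hne
    exact hπ ⟨f, hne, hf⟩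
  intro i
  have hcoeff : f.coeff (i : ℕ) = a i := by
    simp only [f, Polynomial.finsetSum_coeff, Polynomial.coeff_C_mul_X_pow]
    rw [Finset.sum_eq_single i]
    · simp
    · intro j _ hji
      rw [if_neg]
      exact fun hij => hji (Fin.ext hij.symm)
    · simp
  have : a i = 0 := by rw [← hcoeff, hf0, Polynomial.coeff_zero]
  simpa [a] using congrArg Subtype.val this

/-! ## Constants: `IntegralRep 0` -/

/-- **A constant of value `0` is a relation**: its integrand vanishes on its domain (empty, or the
point where the value is the integrand), so integrand additivity applies
(`KZ.of_mem_relations_of_eqOn_zero`). [folklore] -/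
theorem of_mem_relations_of_dim_zero_of_value_eq_zero (r : IntegralRep 0) (h : r.value = 0) :
    of r ∈ relations := by
  apply of_mem_relations_of_eqOn_zero
  intro x hx
  have hxd : x = default := Subsingleton.elim x default
  have hdom : r.domain = univ := by
    refine eq_univ_of_forall fun y => ?_
    rwa [Subsingleton.elim y x]
  have hv : r.value = r.integrand default := by
    rw [IntegralRep.value, hdom, Measure.restrict_univ]
    have : r.integrand = fun _ => r.integrand default := by
      funext y; rw [Subsingleton.elim y default]
    rw [this, integral_const, measureReal_def, volume_univ_fin_zero]
    simp
  rw [hxd, Pi.zero_apply, ← hv, h]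

/-! ## The `π`-polynomial sector of item 0540 -/

/-- **Evaluation is injective on `π`-polynomials with constant coefficients**: if
`x = ∑ᵢ ⟦κᵢ⟧ ⟦π⟧ⁱ` with `κᵢ : IntegralRep 0` and `evalP x = 0`, then `x = 0` — the values
`value κᵢ` are algebraic, so Lindemann forces them all to vanish, and a constant of value `0` is a
relation. [folklore] -/
theorem eq_zero_of_evalP_of_piPolynomial {k : ℕ} (κ : Fin k → IntegralRep 0) {x : FormalPeriodRing}
    (hx : x = ∑ i, toFormalPeriod (of (κ i)) * toFormalPeriod (of piRep) ^ (i : ℕ))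
    (h : evalP x = 0) : x = 0 := by
  have hval : ∑ i, (κ i).value * Real.pi ^ (i : ℕ) = 0 := by
    have := h
    rw [hx, map_sum] at this
    simpa [map_mul, map_pow, evalP_toFormalPeriod_of, piRep_value] using this
  have hzero := eq_zero_of_sum_algebraic_mul_pi_pow (fun i => (κ i).value)
    (fun i => isAlgebraic_value_dimZero (κ i)) hval
  rw [hx]
  refine Finset.sum_eq_zero fun i _ => ?_
  rw [toFormalPeriod_eq_zero_of_mem (of_mem_relations_of_dim_zero_of_value_eq_zero _ (hzero i)),
    zero_mul]

/-- **The `π`-polynomial sector of `π`-cancellation (item stmt-KontsevichZagierPeriods-0540).**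
For every class of the form `x = ∑ᵢ ⟦κᵢ⟧ ⟦π⟧ⁱ` (`κᵢ` constants), `⟦π⟧ * x = 0 → x = 0`.
[folklore] -/
theorem eq_zero_of_piClass_mul_of_piPolynomial {k : ℕ} (κ : Fin k → IntegralRep 0)
    {x : FormalPeriodRing}
    (hx : x = ∑ i, toFormalPeriod (of (κ i)) * toFormalPeriod (of piRep) ^ (i : ℕ))
    (h : toFormalPeriod (of piRep) * x = 0) : x = 0 :=
  eq_zero_of_piClass_mul_of_evalP (eq_zero_of_evalP_of_piPolynomial κ hx) h

/-- **`FormalRep` form of the `π`-polynomial sector**: if `c` is congruent modulo relations to a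
`π`-polynomial with constant coefficients, then `[π] * c ∈ relations → c ∈ relations`.
[folklore] -/
theorem mem_relations_of_piRep_mul_of_piPolynomial {k : ℕ} (κ : Fin k → IntegralRep 0)
    {c : FormalRep}
    (hc : toFormalPeriod c = ∑ i, toFormalPeriod (of (κ i)) * toFormalPeriod (of piRep) ^ (i : ℕ))
    (h : of piRep * c ∈ relations) : c ∈ relations := by
  rw [← toFormalPeriod_eq_zero_iff] at h ⊢
  rw [map_mul] at h
  exact eq_zero_of_piClass_mul_of_piPolynomial κ hc h

/-- **Registered sub-goal `stub_piPolynomialSector`** (the `π`-polynomial SECTOR of the line's open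
stub `stub_piCancellation` = item stmt-KontsevichZagierPeriods-0540, closed form, fully qualified):
for every formal combination `c` congruent modulo relations to `∑ᵢ [κᵢ]·[π]ⁱ` with constant
coefficients `κᵢ : IntegralRep 0`, `[π] * c ∈ relations → c ∈ relations`. [folklore] -/
theorem stub_piPolynomialSector :
    ∀ (k : ℕ) (κ : Fin k → Literature.NumberTheory.Transcendental.KZ.IntegralRep 0)
      (c : Literature.NumberTheory.Transcendental.KZ.FormalRep),
      Literature.NumberTheory.Transcendental.KZ.toFormalPeriod c =
        ∑ i, Literature.NumberTheory.Transcendental.KZ.toFormalPeriod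
            (Literature.NumberTheory.Transcendental.KZ.of (κ i)) *
          Literature.NumberTheory.Transcendental.KZ.toFormalPeriod
            (Literature.NumberTheory.Transcendental.KZ.of
              Literature.NumberTheory.Transcendental.KZ.piRep) ^ (i : ℕ) →
      Literature.NumberTheory.Transcendental.KZ.of Literature.NumberTheory.Transcendental.KZ.piRep * c ∈
          Literature.NumberTheory.Transcendental.KZ.relations →
      c ∈ Literature.NumberTheory.Transcendental.KZ.relations :=
  fun _ κ _ hc h => mem_relations_of_piRep_mul_of_piPolynomial κ hc h

end Summit.KontsevichZagierPeriods.KontsevichZagierPeriods.BetaCancellationLine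

end
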